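import Literature.Probability.Percolation.TriHexBallDomain
import Literature.Probability.Percolation.FiveMarkedLoops
import HarnessLib

/-!
# S0 plumbing for the five-point observable on the smallest five-marked domain

Topic `Literature/Probability/Percolation`; pcv-sawmu door (v), module M2 (lead g8 r110/r113). On the 7-site five-marked
domain `hexBall1Five` (`TriHexBallDomain.lean`) the interface-layer predicates of `FiveMarkedLoops.lean`
(`FivePoint.Bicol`, `IStep`, `InInterface`, `Joined`, `MatchA`, `MatchB`, `IsCornerFace`, `stretchIdx`) are rendered as
FINITE, DECIDABLE objects with proved equivalences, so that statements about them can be evaluated in the kernel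
(`decide`) configuration by configuration:

* geometry: `facesAt s` (the six faces at a site) with `mem_facesAt_iff`, `facesOf G` (the vertex set of `H_G`),
  boundedness `IStep.mem_facesOf` / `HStep.mem_facesOf`, the bounded form `IStepB` of `IStep`;
* tabulation on `hexBall1Five`: corner faces `cornerT` with `isCornerFace_iff`, stretches `stretchS` with
  `stretch_eq_stretchS` and `stretchIdx_eq`, decidable `BicolS`/`IStepS`/`HStepS` with `bicol_iff`, `iStep_iff_S`;
* generic finite closures `expand` with `expand_sound`, `subset_expand_iterate`, `reach_mem_of_closed`;
* `IPset`/`IPclosed` with `inInterface_iff`, `JsetW`/`JclosedW` with `joined_iff` / `joined_iff_of_eq`,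
  `IPfrom` with `matchA_iff` / `matchB_iff`.

First used for the kernel witnesses of the five-point normalisation on `hexBall1Five` (pcv-sawmu, 2026-08-22).
Everything here is finite bookkeeping over Bollobás–Riordan's marked domains [cite: BollobasRiordan2006, Ch. 7 §7.2.2];
no new mathematics.
-/

open Finset Literature.Probability.LatticeModels

noncomputable section

namespace Literature.Probability.Percolation.FivePoint.S0

open Literature.Probability.Percolation Literature.Probability.Percolation.FivePoint

set_option maxRecDepth 400000

/-! ### C1. The six faces at a site; the finite face universe of a site set -/

/-- The six faces of `𝕋` having the site `s` as a vertex. [folklore] -/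
def facesAt (s : Site 2) : Finset HexVertex :=
  {(s, 0), (s - Pi.single 0 1, 0), (s - Pi.single 1 1, 0),
   (s - Pi.single 0 1, 1), (s - Pi.single 1 1, 1), (s - Pi.single 0 1 - Pi.single 1 1, 1)}

/-- `F ∈ facesAt s ↔ s` is a vertex of `F`. [cite: BollobasRiordan2006, Ch. 7 §7.2.2 pp. 168–169] -/
theorem mem_facesAt_iff (s : Site 2) (F : HexVertex) : F ∈ facesAt s ↔ s ∈ hexFaceVertices F := by
  obtain ⟨x, t⟩ := F
  have ht : t = 0 ∨ t = 1 := by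
    rcases t with ⟨t, ht⟩
    interval_cases t
    · exact Or.inl rfl
    · exact Or.inr rfl
  rcases ht with rfl | rfl
  · simp only [facesAt, hexFaceVertices, Fin.isValue, ↓reduceIte, mem_insert, mem_singleton, Prod.mk.injEq,
      and_false, or_false, and_true, zero_ne_one]
    constructor
    · rintro (rfl | rfl | rfl)
      · exact Or.inl rfl
      · exact Or.inr (Or.inl (by rw [sub_add_cancel]))
      · exact Or.inr (Or.inr (by rw [sub_add_cancel]))
    · rintro (rfl | rfl | rfl)
      · exact Or.inl rfl
      · exact Or.inr (Or.inl (by rw [add_sub_cancel_right]))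
      · exact Or.inr (Or.inr (by rw [add_sub_cancel_right]))
  · simp only [facesAt, hexFaceVertices, Fin.isValue, one_ne_zero, ↓reduceIte, mem_insert, mem_singleton,
      Prod.mk.injEq, and_false, false_or, and_true]
    constructor
    · rintro (rfl | rfl | rfl)
      · exact Or.inl (by rw [sub_add_cancel])
      · exact Or.inr (Or.inl (by rw [sub_add_cancel]))
      · exact Or.inr (Or.inr (by abel))
    · rintro (rfl | rfl | rfl)
      · exact Or.inl (by rw [add_sub_cancel_right])
      · exact Or.inr (Or.inl (by rw [add_sub_cancel_right]))
      · exact Or.inr (Or.inr (by abel))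

/-- The faces of `𝕋` having a vertex in `G` — the vertex set of `H_G`. [folklore] -/
def facesOf (G : Finset (Site 2)) : Finset HexVertex := G.biUnion facesAt

/-- Membership in `facesOf`. [cite: BollobasRiordan2006, Ch. 7 §7.2.2 pp. 168–169] -/
theorem mem_facesOf_iff (G : Finset (Site 2)) (F : HexVertex) : F ∈ facesOf G ↔ ∃ s ∈ hexFaceVertices F, s ∈ G := by
  simp only [facesOf, mem_biUnion, mem_facesAt_iff]
  constructor
  · rintro ⟨s, hsG, hsF⟩; exact ⟨s, hsF, hsG⟩
  · rintro ⟨s, hsF, hsG⟩; exact ⟨s, hsG, hsF⟩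

/-! ### C2. Boundedness of `IStep` / `HStep` -/

variable (D : TriMarkedDomain 5)

/-- A site in the common edge of two faces is a vertex of both. [cite: BollobasRiordan2006, Ch. 7 §7.2.2 pp. 168–169] -/
theorem mem_of_mem_faceEdge {F F' : HexVertex} {u : Site 2} (h : u ∈ faceEdge F F') :
    u ∈ hexFaceVertices F ∧ u ∈ hexFaceVertices F' := by
  unfold faceEdge at h
  exact ⟨(mem_inter.1 h).1, (mem_inter.1 h).2⟩

/-- `Bicol` holds only across pairs with a site in `G`. [cite: BollobasRiordan2006, Ch. 7 §7.2.2 pp. 168–169] -/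
theorem Bicol.mem_or {σ : SiteConfig (Site 2)} {r : Fin 5} {c : Bool} {u v : Site 2}
    (h : Bicol D σ r c u v) : u ∈ D.verts ∨ v ∈ D.verts := by
  rcases h with h | h | h
  · exact Or.inl h.1
  · exact Or.inl h.1
  · exact Or.inr h.1

/-- An `IStep` runs inside the finite face universe `facesOf G`. [cite: BollobasRiordan2006, Ch. 7 §7.2.2 pp. 168–169] -/
theorem IStep.mem_facesOf {σ : SiteConfig (Site 2)} {r : Fin 5} {c : Bool} {F F' : HexVertex}
    (h : IStep D σ r c F F') : F ∈ facesOf D.verts ∧ F' ∈ facesOf D.verts := by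
  obtain ⟨-, u, v, hfe, hb⟩ := h
  have hu : u ∈ faceEdge F F' := by rw [hfe]; exact mem_insert_self _ _
  have hv : v ∈ faceEdge F F' := by rw [hfe]; exact mem_insert_of_mem (mem_singleton_self _)
  rcases Bicol.mem_or D hb with hG | hG
  · exact ⟨(mem_facesOf_iff _ _).2 ⟨u, (mem_of_mem_faceEdge hu).1, hG⟩, (mem_facesOf_iff _ _).2 ⟨u, (mem_of_mem_faceEdge hu).2, hG⟩⟩
  · exact ⟨(mem_facesOf_iff _ _).2 ⟨v, (mem_of_mem_faceEdge hv).1, hG⟩, (mem_facesOf_iff _ _).2 ⟨v, (mem_of_mem_faceEdge hv).2, hG⟩⟩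

/-- An `HStep` runs inside `facesOf G`. [cite: BollobasRiordan2006, Ch. 7 §7.2.2 pp. 168–169] -/
theorem HStep.mem_facesOf {F F' : HexVertex} (h : HStep D F F') : F ∈ facesOf D.verts ∧ F' ∈ facesOf D.verts := by
  obtain ⟨-, u, hu, hG⟩ := h
  exact ⟨(mem_facesOf_iff _ _).2 ⟨u, (mem_of_mem_faceEdge hu).1, hG⟩, (mem_facesOf_iff _ _).2 ⟨u, (mem_of_mem_faceEdge hu).2, hG⟩⟩

/-! ### C3. Bounded (decidable) forms of `IStep` and `HStep` -/

/-- `IStep` with the existential bounded by the common edge. [cite: BollobasRiordan2006, Ch. 7 §7.2.2 pp. 168–171] -/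
def IStepB (σ : SiteConfig (Site 2)) (r : Fin 5) (c : Bool) (F F' : HexVertex) : Prop :=
  hexGraph.Adj F F' ∧ ∃ u ∈ faceEdge F F', ∃ v ∈ faceEdge F F', faceEdge F F' = {u, v} ∧ Bicol D σ r c u v

/-- Finite bookkeeping on `hexBall1Five`. [cite: BollobasRiordan2006, Ch. 7 §7.2.2 pp. 168–169] -/
theorem iStep_iff_iStepB (σ : SiteConfig (Site 2)) (r : Fin 5) (c : Bool) (F F' : HexVertex) :
    IStep D σ r c F F' ↔ IStepB D σ r c F F' := by
  constructor
  · rintro ⟨hadj, u, v, hfe, hb⟩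
    refine ⟨hadj, u, ?_, v, ?_, hfe, hb⟩
    · rw [hfe]; exact mem_insert_self _ _
    · rw [hfe]; exact mem_insert_of_mem (mem_singleton_self _)
  · rintro ⟨hadj, u, -, v, -, hfe, hb⟩
    exact ⟨hadj, u, v, hfe, hb⟩


/-! ### C4. Tabulation on `hexBall1Five`: corner faces, stretches, a decidable `Bicol` -/

/-- The five corner faces `y_0, …, y_4` of `hexBall1Five` (from the enumeration side; proved below to be exactly the
faces satisfying `IsCornerFace`). [folklore] -/
def cornerT : Fin 5 → HexVertex :=
  ![(![1, -1], 1), (![0, 1], 0), (![-2, 1], 1), (![-2, 0], 0), (![-1, -2], 1)]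

/-- `IsCornerFace hexBall1Five j Y ↔ Y = cornerT j`. [cite: BollobasRiordan2006, Ch. 7 §7.2.2 pp. 168–169] -/
theorem isCornerFace_iff (j : Fin 5) (Y : HexVertex) : IsCornerFace hexBall1Five j Y ↔ Y = cornerT j := by
  constructor
  · intro h
    have hY : Y ∈ facesAt (hexBall1Five.markSite j) := by
      rw [mem_facesAt_iff]; unfold IsCornerFace at h; rw [h]; exact mem_insert_self _ _
    have key : ∀ j : Fin 5, ∀ Y ∈ facesAt (hexBall1Five.markSite j), IsCornerFace hexBall1Five j Y → Y = cornerT j := by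
      unfold IsCornerFace predDart; decide
    exact key j Y hY h
  · rintro rfl
    revert j
    unfold IsCornerFace predDart
    decide

/-- The five stretches of `hexBall1Five` as explicit dart sets (positions `0–2, 3–5, 6–8, 9–11, 12–17`). [folklore] -/
def stretchS : Fin 5 → Finset (Site 2 × Site 2) :=
  ![{(![1, 0], ![2, 0]), (![1, 0], ![1, 1]), (![0, 1], ![1, 1])},
    {(![0, 1], ![0, 2]), (![0, 1], ![-1, 2]), (![-1, 1], ![-1, 2])},
    {(![-1, 1], ![-2, 2]), (![-1, 1], ![-2, 1]), (![-1, 0], ![-2, 1])},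
    {(![-1, 0], ![-2, 0]), (![-1, 0], ![-1, -1]), (![0, -1], ![-1, -1])},
    {(![0, -1], ![0, -2]), (![0, -1], ![1, -2]), (![1, -1], ![1, -2]), (![1, -1], ![2, -2]), (![1, -1], ![2, -1]),
      (![1, 0], ![2, -1])}]

/-- The stretches of `hexBall1Five` are the tabulated ones. [cite: BollobasRiordan2006, Ch. 7 §7.2.2 pp. 168–171] -/
@[simp] theorem stretch_eq_stretchS (i : Fin 5) : hexBall1Five.stretch i = stretchS i := by
  fin_cases i <;> decide

/-- Tabulated stretch index (same formula as `stretchIdx`, on the explicit stretch table). [folklore] -/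
def stretchT (d : Site 2 × Site 2) : Fin 5 :=
  if h : (Finset.univ.filter fun i : Fin 5 => d ∈ stretchS i).Nonempty then
    (Finset.univ.filter fun i : Fin 5 => d ∈ stretchS i).min' h
  else 0

/-- `stretchIdx hexBall1Five = stretchT`. [cite: BollobasRiordan2006, Ch. 7 §7.2.2 pp. 168–169] -/
theorem stretchIdx_eq (d : Site 2 × Site 2) : stretchIdx hexBall1Five d = stretchT d := by
  unfold stretchIdx stretchT
  simp only [stretch_eq_stretchS]

/-- Decidable membership in a coerced finite set of sites. [folklore] -/
instance decMemCoe (S : Finset (Site 2)) : DecidablePred (· ∈ (↑S : Set (Site 2))) :=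
  fun a => decidable_of_iff (a ∈ S) Finset.mem_coe.symm

/-- `Bicol` on `hexBall1Five` with the configuration given by a finite set of open sites, in decidable form. [cite: BollobasRiordan2006, Ch. 7 §7.2.2 pp. 168–171] -/
def BicolS (S : Finset (Site 2)) (r : Fin 5) (c : Bool) (u v : Site 2) : Prop :=
  (u ∈ triBall 1 ∧ v ∈ triBall 1 ∧ (u ∈ S ↔ v ∉ S)) ∨
  (u ∈ triBall 1 ∧ v ∉ triBall 1 ∧ (u ∈ S ↔ arcColour r c (stretchT (u, v)) = false)) ∨
  (v ∈ triBall 1 ∧ u ∉ triBall 1 ∧ (v ∈ S ↔ arcColour r c (stretchT (v, u)) = false))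

/-- Decidability instance (finite bookkeeping). [folklore] -/
instance (S : Finset (Site 2)) (r : Fin 5) (c : Bool) (u v : Site 2) : Decidable (BicolS S r c u v) := by
  unfold BicolS; infer_instance

/-- Finite bookkeeping on `hexBall1Five`. [cite: BollobasRiordan2006, Ch. 7 §7.2.2 pp. 168–169] -/
theorem bicol_iff (S : Finset (Site 2)) (r : Fin 5) (c : Bool) (u v : Site 2) :
    Bicol hexBall1Five (↑S) r c u v ↔ BicolS S r c u v := by
  unfold Bicol BicolS
  simp only [hexBall1Five_verts, mem_coe, stretchIdx_eq]

/-- Decidable `IStep` on `hexBall1Five`. [cite: BollobasRiordan2006, Ch. 7 §7.2.2 pp. 168–171] -/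
def IStepS (S : Finset (Site 2)) (r : Fin 5) (c : Bool) (F F' : HexVertex) : Prop :=
  hexGraph.Adj F F' ∧ ∃ u ∈ faceEdge F F', ∃ v ∈ faceEdge F F', faceEdge F F' = {u, v} ∧ BicolS S r c u v

/-- Decidability instance (finite bookkeeping). [folklore] -/
instance (S : Finset (Site 2)) (r : Fin 5) (c : Bool) : DecidableRel (IStepS S r c) := by
  unfold IStepS; infer_instance

/-- Finite bookkeeping on `hexBall1Five`. [cite: BollobasRiordan2006, Ch. 7 §7.2.2 pp. 168–169] -/
theorem iStep_iff_S (S : Finset (Site 2)) (r : Fin 5) (c : Bool) (F F' : HexVertex) :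
    IStep hexBall1Five (↑S) r c F F' ↔ IStepS S r c F F' := by
  rw [iStep_iff_iStepB]
  unfold IStepB IStepS
  simp only [bicol_iff]

/-- The two step relations coincide (as relations). [cite: BollobasRiordan2006, Ch. 7 §7.2.2 pp. 168–169] -/
theorem iStep_eq_S (S : Finset (Site 2)) (r : Fin 5) (c : Bool) :
    IStep hexBall1Five (↑S) r c = IStepS S r c := by
  funext F F'; exact propext (iStep_iff_S S r c F F')

/-- Decidable `HStep` on `hexBall1Five`. [cite: BollobasRiordan2006, Ch. 7 §7.2.2 pp. 168–171] -/
def HStepS (F F' : HexVertex) : Prop :=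
  hexGraph.Adj F F' ∧ ∃ u ∈ faceEdge F F', u ∈ triBall 1

/-- Decidability instance (finite bookkeeping). [folklore] -/
instance : DecidableRel HStepS := by
  unfold HStepS; infer_instance

/-- Finite bookkeeping on `hexBall1Five`. [cite: BollobasRiordan2006, Ch. 7 §7.2.2 pp. 168–169] -/
theorem hStep_iff_S (F F' : HexVertex) : HStep hexBall1Five F F' ↔ HStepS F F' := Iff.rfl

/-! ### C5. Finite closures -/

/-- One expansion step: add every face of `U` reachable in one `step` from the current set. [folklore] -/
def expand (U : Finset HexVertex) (step : HexVertex → HexVertex → Prop) [DecidableRel step]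
    (R : Finset HexVertex) : Finset HexVertex :=
  R ∪ U.filter fun F' => ∃ F ∈ R, step F F'

/-- Everything in an iterated expansion of `src` is reachable from `src`. [cite: BollobasRiordan2006, Ch. 7 §7.2.2 pp. 168–169] -/
theorem expand_sound (U : Finset HexVertex) (step : HexVertex → HexVertex → Prop) [DecidableRel step]
    (src : Finset HexVertex) : ∀ (n : ℕ) {F : HexVertex}, F ∈ (expand U step)^[n] src →
      ∃ y ∈ src, Relation.ReflTransGen step y F := by
  intro n
  induction n with
  | zero => intro F hF; exact ⟨F, hF, Relation.ReflTransGen.refl⟩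
  | succ n ih =>
    intro F hF
    rw [Function.iterate_succ_apply'] at hF
    rcases mem_union.1 hF with h | h
    · exact ih h
    · obtain ⟨-, F₀, hF₀, hst⟩ := mem_filter.1 h
      obtain ⟨y, hy, hreach⟩ := ih hF₀
      exact ⟨y, hy, hreach.tail hst⟩

/-- The source lies in every iterated expansion. [cite: BollobasRiordan2006, Ch. 7 §7.2.2 pp. 168–169] -/
theorem subset_expand_iterate (U : Finset HexVertex) (step : HexVertex → HexVertex → Prop) [DecidableRel step]
    (src : Finset HexVertex) : ∀ n : ℕ, src ⊆ (expand U step)^[n] src := by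
  intro n
  induction n with
  | zero => exact Subset.rfl
  | succ n ih =>
    intro F hF
    rw [Function.iterate_succ_apply']
    exact mem_union_left _ (ih hF)

/-- A set containing the source and closed under `step` contains everything reachable. [cite: BollobasRiordan2006, Ch. 7 §7.2.2 pp. 168–169] -/
theorem reach_mem_of_closed {step : HexVertex → HexVertex → Prop} {C src : Finset HexVertex} (hsrc : src ⊆ C)
    (hcl : ∀ F ∈ C, ∀ F', step F F' → F' ∈ C) {y F : HexVertex} (hy : y ∈ src)
    (h : Relation.ReflTransGen step y F) : F ∈ C := by
  induction h with
  | refl => exact hsrc hy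
  | tail _ hst ih => exact hcl _ ih _ hst

/-! ### C6. `InInterface` and `Joined` on `hexBall1Five` as finite sets -/

/-- The finite face universe of `hexBall1Five`. [folklore] -/
def U1 : Finset HexVertex := facesOf (triBall 1)

/-- Sources of the interface part: the corner faces of the four marks other than `r`. [folklore] -/
def srcIP (r : Fin 5) : Finset HexVertex := (Finset.univ.filter fun j : Fin 5 => j ≠ r).image cornerT

/-- The interface part under `(S, r, c)` as a finite set: closure of the corner faces `j ≠ r` under `IStepS`. [folklore] -/
def IPset (S : Finset (Site 2)) (r : Fin 5) (c : Bool) : Finset HexVertex :=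
  (expand U1 (IStepS S r c))^[12] (srcIP r)

/-- Closedness of `IPset` (a decidable proposition, checked configuration by configuration). [cite: BollobasRiordan2006, Ch. 7 §7.2.2 pp. 168–171] -/
def IPclosed (S : Finset (Site 2)) (r : Fin 5) (c : Bool) : Prop :=
  ∀ F ∈ IPset S r c, ∀ F' ∈ U1, IStepS S r c F F' → F' ∈ IPset S r c

/-- Decidability instance (finite bookkeeping). [folklore] -/
instance (S : Finset (Site 2)) (r : Fin 5) (c : Bool) : Decidable (IPclosed S r c) := by
  unfold IPclosed; infer_instance

/-- **`InInterface` rendered**: when `IPset` is closed, `InInterface hexBall1Five ↑S r c F ↔ F ∈ IPset S r c`. [cite: BollobasRiordan2006, Ch. 7 §7.2.2 pp. 168–169] -/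
theorem inInterface_iff (S : Finset (Site 2)) (r : Fin 5) (c : Bool) (hcl : IPclosed S r c) (F : HexVertex) :
    InInterface hexBall1Five (↑S) r c F ↔ F ∈ IPset S r c := by
  constructor
  · rintro ⟨j, hj, Y, hY, hreach⟩
    rw [isCornerFace_iff] at hY
    subst hY
    rw [iStep_eq_S] at hreach
    have hsrc : cornerT j ∈ srcIP r := mem_image.2 ⟨j, mem_filter.2 ⟨mem_univ _, hj⟩, rfl⟩
    refine reach_mem_of_closed (subset_expand_iterate U1 (IStepS S r c) (srcIP r) 12) ?_ hsrc hreach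
    intro F₀ hF₀ F' hst
    have hU : F' ∈ U1 := by
      have := (IStep.mem_facesOf hexBall1Five ((iStep_iff_S S r c F₀ F').2 hst)).2
      simpa [U1] using this
    exact hcl F₀ hF₀ F' hU hst
  · intro hF
    obtain ⟨y, hy, hreach⟩ := expand_sound U1 (IStepS S r c) (srcIP r) 12 hF
    obtain ⟨j, hj, rfl⟩ := mem_image.1 hy
    refine ⟨j, (mem_filter.1 hj).2, cornerT j, (isCornerFace_iff j _).2 rfl, ?_⟩
    rw [iStep_eq_S]; exact hreach

/-- `H_G`-steps between faces off a given face set `IP`, in decidable form. [cite: BollobasRiordan2006, Ch. 7 §7.2.2 pp. 168–171] -/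
def HOffW (IP : Finset HexVertex) (F F' : HexVertex) : Prop :=
  HStepS F F' ∧ F ∉ IP ∧ F' ∉ IP

/-- Decidability instance (finite bookkeeping). [folklore] -/
instance (IP : Finset HexVertex) : DecidableRel (HOffW IP) := by
  unfold HOffW; infer_instance

/-- The faces joined to `y_r` off `IP`: closure of `{y_r}` under `HOffW IP` (14 rounds; completeness is certified by
the closedness check, not by the round count). [folklore] -/
def JsetW (IP : Finset HexVertex) (r : Fin 5) : Finset HexVertex :=
  (expand U1 (HOffW IP))^[14] {cornerT r}

/-- Closedness of `JsetW`. [cite: BollobasRiordan2006, Ch. 7 §7.2.2 pp. 168–171] -/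
def JclosedW (IP : Finset HexVertex) (r : Fin 5) : Prop :=
  ∀ F ∈ JsetW IP r, ∀ F' ∈ U1, HOffW IP F F' → F' ∈ JsetW IP r

/-- Decidability instance (finite bookkeeping). [folklore] -/
instance (IP : Finset HexVertex) (r : Fin 5) : Decidable (JclosedW IP r) := by
  unfold JclosedW; infer_instance

/-- `H_G`-steps off the interface part of `(S, r, c)`. [cite: BollobasRiordan2006, Ch. 7 §7.2.2 pp. 168–171] -/
def HOff (S : Finset (Site 2)) (r : Fin 5) (c : Bool) : HexVertex → HexVertex → Prop := HOffW (IPset S r c)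

/-- Decidability instance (finite bookkeeping). [folklore] -/
instance (S : Finset (Site 2)) (r : Fin 5) (c : Bool) : DecidableRel (HOff S r c) := by
  unfold HOff; infer_instance

/-- The faces joined to `y_r` under `(S, r, c)`. [folklore] -/
def Jset (S : Finset (Site 2)) (r : Fin 5) (c : Bool) : Finset HexVertex := JsetW (IPset S r c) r

/-- Closedness of `Jset`. [cite: BollobasRiordan2006, Ch. 7 §7.2.2 pp. 168–171] -/
def Jclosed (S : Finset (Site 2)) (r : Fin 5) (c : Bool) : Prop := JclosedW (IPset S r c) r

/-- **`Joined` rendered**: when both closures are closed,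
`Joined hexBall1Five ↑S r c x ↔ y_r ∉ IPset ∧ x ∈ Jset`. [cite: BollobasRiordan2006, Ch. 7 §7.2.2 pp. 168–169] -/
theorem joined_iff (S : Finset (Site 2)) (r : Fin 5) (c : Bool) (hI : IPclosed S r c) (hJ : Jclosed S r c)
    (x : HexVertex) : Joined hexBall1Five (↑S) r c x ↔ cornerT r ∉ IPset S r c ∧ x ∈ Jset S r c := by
  unfold Jclosed JclosedW at hJ
  unfold Jset
  have hrel : (fun F F' => HStep hexBall1Five F F' ∧ ¬ InInterface hexBall1Five (↑S) r c F ∧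
      ¬ InInterface hexBall1Five (↑S) r c F') = HOff S r c := by
    funext F F'
    exact propext (by rw [hStep_iff_S, inInterface_iff S r c hI, inInterface_iff S r c hI]; rfl)
  constructor
  · rintro ⟨hx, Y, hY, hYI, hreach⟩
    rw [isCornerFace_iff] at hY
    subst hY
    rw [inInterface_iff S r c hI] at hYI
    rw [hrel] at hreach
    refine ⟨hYI, reach_mem_of_closed (subset_expand_iterate U1 (HOff S r c) {cornerT r} 14) ?_ (mem_singleton_self _) hreach⟩
    intro F₀ hF₀ F' hst
    have hU : F' ∈ U1 := by
      have := (HStep.mem_facesOf hexBall1Five ((hStep_iff_S F₀ F').2 hst.1)).2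
      simpa [U1] using this
    exact hJ F₀ hF₀ F' hU hst
  · rintro ⟨hYI, hx⟩
    obtain ⟨y, hy, hreach⟩ := expand_sound U1 (HOff S r c) {cornerT r} 14 hx
    rw [mem_singleton] at hy
    subst hy
    have hxI : x ∉ IPset S r c := by
      -- the last step of the chain (or x = y_r) is off the interface part
      rcases Relation.ReflTransGen.cases_tail hreach with h | ⟨F₀, -, hst⟩
      · rw [h]; exact hYI
      · exact hst.2.2
    refine ⟨(inInterface_iff S r c hI x).not.2 hxI, cornerT r, (isCornerFace_iff r _).2 rfl,
      (inInterface_iff S r c hI _).not.2 hYI, ?_⟩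
    rw [hrel]; exact hreach

/-! ### C6b. `MatchA` / `MatchB` as finite reachability -/

/-- The interface through the corner of mark `j`: closure of `{y_j}` under `IStepS`. [folklore] -/
def IPfrom (S : Finset (Site 2)) (r : Fin 5) (c : Bool) (j : Fin 5) : Finset HexVertex :=
  (expand U1 (IStepS S r c))^[18] {cornerT j}

/-- Closedness of `IPfrom`. [cite: BollobasRiordan2006, Ch. 7 §7.2.2 pp. 168–171] -/
def IPfromClosed (S : Finset (Site 2)) (r : Fin 5) (c : Bool) (j : Fin 5) : Prop :=
  ∀ F ∈ IPfrom S r c j, ∀ F' ∈ U1, IStepS S r c F F' → F' ∈ IPfrom S r c j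

/-- Decidability instance (finite bookkeeping). [folklore] -/
instance (S : Finset (Site 2)) (r : Fin 5) (c : Bool) (j : Fin 5) : Decidable (IPfromClosed S r c j) := by
  unfold IPfromClosed; infer_instance

/-- Linking of two corner faces through bicoloured edges, rendered. [cite: BollobasRiordan2006, Ch. 7 §7.2.2 pp. 168–169] -/
theorem linked_iff (S : Finset (Site 2)) (r : Fin 5) (c : Bool) (j j' : Fin 5) (hcl : IPfromClosed S r c j) :
    (∃ Y₁ Y₂ : HexVertex, IsCornerFace hexBall1Five j Y₁ ∧ IsCornerFace hexBall1Five j' Y₂ ∧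
      Relation.ReflTransGen (IStep hexBall1Five (↑S) r c) Y₁ Y₂) ↔ cornerT j' ∈ IPfrom S r c j := by
  constructor
  · rintro ⟨Y₁, Y₂, h₁, h₂, hreach⟩
    rw [isCornerFace_iff] at h₁ h₂
    subst h₁; subst h₂
    rw [iStep_eq_S] at hreach
    refine reach_mem_of_closed (subset_expand_iterate U1 (IStepS S r c) {cornerT j} 18) ?_ (mem_singleton_self _) hreach
    intro F₀ hF₀ F' hst
    have hU : F' ∈ U1 := by
      have := (IStep.mem_facesOf hexBall1Five ((iStep_iff_S S r c F₀ F').2 hst)).2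
      simpa [U1] using this
    exact hcl F₀ hF₀ F' hU hst
  · intro h
    obtain ⟨y, hy, hreach⟩ := expand_sound U1 (IStepS S r c) {cornerT j} 18 h
    rw [mem_singleton] at hy
    subst hy
    refine ⟨cornerT j, cornerT j', (isCornerFace_iff j _).2 rfl, (isCornerFace_iff j' _).2 rfl, ?_⟩
    rw [iStep_eq_S]; exact hreach

/-- **`MatchA` rendered.** [cite: BollobasRiordan2006, Ch. 7 §7.2.2 pp. 168–169] -/
theorem matchA_iff (S : Finset (Site 2)) (r : Fin 5) (c : Bool) (hcl : IPfromClosed S r c (r + 1)) :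
    MatchA hexBall1Five (↑S) r c ↔ cornerT (r + 2) ∈ IPfrom S r c (r + 1) :=
  linked_iff S r c (r + 1) (r + 2) hcl

/-- **`MatchB` rendered.** [cite: BollobasRiordan2006, Ch. 7 §7.2.2 pp. 168–169] -/
theorem matchB_iff (S : Finset (Site 2)) (r : Fin 5) (c : Bool) (hcl : IPfromClosed S r c (r + 1)) :
    MatchB hexBall1Five (↑S) r c ↔ cornerT (r + 4) ∈ IPfrom S r c (r + 1) :=
  linked_iff S r c (r + 1) (r + 4) hcl

/-- `Joined` rendered against a precomputed interface part `IP = IPset S r c` (so that the kernel evaluates the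
interface closure once). [cite: BollobasRiordan2006, Ch. 7 §7.2.2 pp. 168–169] -/
theorem joined_iff_of_eq (S : Finset (Site 2)) (r : Fin 5) (c : Bool) (hI : IPclosed S r c) {IP : Finset HexVertex}
    (hIP : IPset S r c = IP) (hJ : JclosedW IP r) (x : HexVertex) :
    Joined hexBall1Five (↑S) r c x ↔ cornerT r ∉ IP ∧ x ∈ JsetW IP r := by
  subst hIP
  exact joined_iff S r c hI hJ x

end Literature.Probability.Percolation.FivePoint.S0

end
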